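import Literature.Computability.AlgebraicComplexity.RectangularExponentBounds
import Literature.Computability.AlgebraicComplexity.AsymptoticRankMatMul
import Literature.Barriers.MatrixMultiplication.UniversalMethodBarrierCor28
import HarnessLib

/-!
# `ω(a, b, c) = log_q R̃(⟨q^a, q^b, q^c⟩)` — the definition of the rectangular exponents by the
asymptotic rank (Alman–Duan–Vassilevska Williams–Xu–Xu–Zhou 2025, §3.4) agrees with the tree's

Topic `Literature/Computability/AlgebraicComplexity`.  ADVXXZ, *More asymmetry yields faster matrix
multiplication* (SODA 2025, arXiv:2404.16349), §3.4 DEFINE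

> `ω(a,b,c) = log_q (R̃(⟨q^a, q^b, q^c⟩))` where `q ≥ 2` is a positive integer

(after "`⟨a,b,c⟩ ⊗ ⟨d,e,f⟩ ≡ ⟨ad, be, cf⟩`" and "`ω = log_q(R̃(⟨q,q,q⟩))`").  The tree's exponents are
the rank-form ones of Le Gall 2012, `omegaRect K a b c = inf {β | R(⟨⌈n^a⌉, ⌈n^b⌉, ⌈n^c⌉⟩) = O(n^β)}`
(`RectangularExponent.lean`).  This file PROVES that the two agree for natural exponents `a, b, c`
(where `q^a, q^b, q^c` are honest matrix formats) and every base `q ≥ 2`: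

* `tensorRank_kroneckerPow_matMulTensor` — `R(⟨k,m,n⟩^{⊗L}) = R(⟨k^L, m^L, n^L⟩)` (the power IS the
  big matrix tensor up to relabelling the indices, `kroneckerPow_matMulTensor_eq_comp` of
  `AsymptoticRankMatMul.lean`);
* `rectDim_natCast` — `⌈N^a⌉ = N^a` for `a ∈ ℕ`;
* `rpow_omegaRect_le_asymptoticRank_matMulTensor` — `q^{ω(a,b,c)} ≤ R̃(⟨q^a,q^b,q^c⟩)`: if
  `R(T^{⊗n₀}) ≤ (R̃ + δ)^{n₀}` then, along `n = q^{n₀ i}` and by padding in between,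
  `R(⟨⌈n^a⌉,⌈n^b⌉,⌈n^c⌉⟩) ≤ (R̃+δ)^{n₀} · n^{log_q(R̃+δ)}`, so `log_q(R̃ + δ)` is admissible;
* `asymptoticRank_matMulTensor_le_rpow_omegaRect` — `R̃(⟨q^a,q^b,q^c⟩) ≤ q^{ω(a,b,c)}`: for `β`
  admissible, `R(T^{⊗n}) = R(⟨(q^n)^a, (q^n)^b, (q^n)^c⟩) ≤ C (q^n)^β` eventually, and
  `R̃ ≤ R(T^{⊗n})^{1/n}`;
* `asymptoticRank_matMulTensor_rect` — `R̃(⟨q^a,q^b,q^c⟩) = q^{ω(a,b,c)}`, and the printed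
  definition `advxxz2025_omegaRect_eq_logb_asymptoticRank` — `ω(a,b,c) = log_q R̃(⟨q^a,q^b,q^c⟩)`
  (`q ≥ 2`; the square case `a = b = c = 1` is `advxxz2025_omega_eq_logb_asymptoticRank`).

Everything is proved; no definitions, no named facts.

## References

* J. Alman, R. Duan, V. Vassilevska Williams, Y. Xu, Z. Xu, R. Zhou, *More asymmetry yields faster
  matrix multiplication*, SODA 2025, arXiv:2404.16349 (held: `paper:arxiv-2404.16349`, chunk p0009),
  §3.4. [AlmanDuanVassilevskaWilliamsXuXuZhou2025]
* F. Le Gall, *Faster algorithms for rectangular matrix multiplication*, FOCS 2012, §2 (rank form of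
  `ω(1,1,k)`). [LeGall2012]
-/

noncomputable section

open Filter Asymptotics

namespace Literature.Computability.AlgebraicComplexity

open Literature.Barriers.MatrixMultiplication (one_le_asymptoticRank_of_ne_zero asymptoticRank_le_rpow)

section RankOfPowers

variable (K : Type) [Field K]

/-- **`R(⟨k,m,n⟩^{⊗L}) = R(⟨k^L, m^L, n^L⟩)`**: the Kronecker power of a matrix multiplication
tensor is the big matrix multiplication tensor with its double indices read in base `k`, `m`, `n`
("`⟨a,b,c⟩ ⊗ ⟨d,e,f⟩ ≡ ⟨ad, be, cf⟩`", "`⟨q,q,q⟩^{⊗n} ≡ ⟨qⁿ,qⁿ,qⁿ⟩`"), and relabelling the indices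
along bijections does not change the rank. [cite: AlmanDuanVassilevskaWilliamsXuXuZhou2025, §3.4] -/
theorem tensorRank_kroneckerPow_matMulTensor (k m n L : ℕ) :
    tensorRank (kroneckerPow (matMulTensor K k m n) L) =
      tensorRank (matMulTensor K (k ^ L) (m ^ L) (n ^ L)) := by
  -- the three relabelling bijections `(Fin L → Fin u × Fin v) ≃ Fin (u^L) × Fin (v^L)`
  rw [kroneckerPow_matMulTensor_eq_comp K k m n L]
  exact tensorRank_reindex
    ((Equiv.arrowProdEquivProdArrow (Fin L) (fun _ => Fin k) (fun _ => Fin n)).trans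
      (Equiv.prodCongr finFunctionFinEquiv finFunctionFinEquiv))
    ((Equiv.arrowProdEquivProdArrow (Fin L) (fun _ => Fin k) (fun _ => Fin m)).trans
      (Equiv.prodCongr finFunctionFinEquiv finFunctionFinEquiv))
    ((Equiv.arrowProdEquivProdArrow (Fin L) (fun _ => Fin m) (fun _ => Fin n)).trans
      (Equiv.prodCongr finFunctionFinEquiv finFunctionFinEquiv))
    (matMulTensor K (k ^ L) (m ^ L) (n ^ L))

/-- Powers of powers: `R(⟨k,m,n⟩^{⊗(L i)}) ≤ R(⟨k,m,n⟩^{⊗L})^i`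
(`⟨k,m,n⟩^{⊗ L i} ≃ ⟨k^L, m^L, n^L⟩^{⊗ i}` and sub-multiplicativity of the rank). [folklore] -/
theorem tensorRank_kroneckerPow_matMulTensor_mul_le (k m n L i : ℕ) :
    tensorRank (kroneckerPow (matMulTensor K k m n) (L * i)) ≤
      tensorRank (kroneckerPow (matMulTensor K k m n) L) ^ i := by
  rw [tensorRank_kroneckerPow_matMulTensor, tensorRank_kroneckerPow_matMulTensor, pow_mul, pow_mul,
    pow_mul, ← tensorRank_kroneckerPow_matMulTensor K (k ^ L) (m ^ L) (n ^ L) i]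
  exact tensorRank_kroneckerPow_le _ i

end RankOfPowers

/-! ## Rectangular dimensions at natural exponents -/

/-- `⌈N^a⌉ = N^a` for a natural exponent `a`. [folklore] -/
theorem rectDim_natCast (N a : ℕ) : rectDim N (a : ℝ) = N ^ a := by
  unfold rectDim
  rw [Real.rpow_natCast, ← Nat.cast_pow, Nat.ceil_natCast]

/-! ## `R̃(⟨q^a, q^b, q^c⟩) = q^{ω(a,b,c)}` -/

section Main

variable (K : Type) [Field K]

/-- The matrix multiplication tensor with positive formats is non-zero, so `R̃ ≥ 1`. [folklore] -/
theorem one_le_asymptoticRank_matMulTensor {A B C : ℕ} (hA : 1 ≤ A) (hB : 1 ≤ B) (hC : 1 ≤ C) :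
    1 ≤ asymptoticRank (matMulTensor K A B C) := by
  refine one_le_asymptoticRank_of_ne_zero fun h0 => ?_
  have e := congrFun (congrFun (congrFun h0 (⟨0, hA⟩, ⟨0, hC⟩)) (⟨0, hA⟩, ⟨0, hB⟩)) (⟨0, hB⟩, ⟨0, hC⟩)
  simp [matMulTensor] at e

/-- From the infimum: some power has `R(T^{⊗n₀}) ≤ (R̃(T) + δ)^{n₀}`, `n₀ ≥ 1`. [folklore] -/
theorem exists_tensorRank_kroneckerPow_le_pow {ι κ μ : Type} [Fintype ι] [Fintype κ] [Fintype μ]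
    (t : ι → κ → μ → K) {δ : ℝ} (hδ : 0 < δ) :
    ∃ n₀ : ℕ, 1 ≤ n₀ ∧ (tensorRank (kroneckerPow t n₀) : ℝ) ≤ (asymptoticRank t + δ) ^ n₀ := by
  have hlt : asymptoticRank t < asymptoticRank t + δ := lt_add_of_pos_right _ hδ
  set A := asymptoticRank t + δ with hA
  unfold asymptoticRank at hlt
  obtain ⟨N, hN⟩ := exists_lt_of_ciInf_lt hlt
  refine ⟨N + 1, Nat.succ_pos N, ?_⟩
  have hR0 : (0 : ℝ) ≤ tensorRank (kroneckerPow t (N + 1)) := Nat.cast_nonneg _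
  have hN1 : (0 : ℝ) < (N : ℝ) + 1 := by positivity
  have hA0 : 0 ≤ A := le_trans (Real.rpow_nonneg hR0 _) hN.le
  have h1 : ((tensorRank (kroneckerPow t (N + 1)) : ℝ) ^ ((N : ℝ) + 1)⁻¹) ^ ((N : ℝ) + 1) ≤
      A ^ ((N : ℝ) + 1) :=
    Real.rpow_le_rpow (Real.rpow_nonneg hR0 _) hN.le hN1.le
  rw [← Real.rpow_mul hR0, inv_mul_cancel₀ hN1.ne', Real.rpow_one] at h1
  have h2 : A ^ ((N : ℝ) + 1) = A ^ (N + 1) := by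
    rw [← Real.rpow_natCast]
    push_cast
    rfl
  rwa [h2] at h1

/-- **`q^{ω(a,b,c)} ≤ R̃(⟨q^a, q^b, q^c⟩)`** for natural `a, b, c` and `q ≥ 2`: every
`log_q(R̃ + δ)`, `δ > 0`, is an admissible exponent.  Indeed if `R(T^{⊗n₀}) ≤ (R̃+δ)^{n₀}`
(`T = ⟨q^a,q^b,q^c⟩`, `n₀ ≥ 1`) then for `q^{n₀ i} ≤ n < q^{n₀ (i+1)}`, padding and
`R(⟨(q^{n₀(i+1)})^a, …⟩) = R(T^{⊗ n₀(i+1)}) ≤ R(T^{⊗n₀})^{i+1}` give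
`R(⟨⌈n^a⌉,⌈n^b⌉,⌈n^c⌉⟩) ≤ (R̃+δ)^{n₀} · n^{log_q(R̃+δ)}`. [cite: AlmanDuanVassilevskaWilliamsXuXuZhou2025, §3.4] -/
theorem rpow_omegaRect_le_asymptoticRank_matMulTensor {q : ℕ} (hq : 2 ≤ q) (a b c : ℕ) :
    (q : ℝ) ^ omegaRect K a b c ≤ asymptoticRank (matMulTensor K (q ^ a) (q ^ b) (q ^ c)) := by
  set T := matMulTensor K (q ^ a) (q ^ b) (q ^ c) with hT
  set r := asymptoticRank T with hr
  have hq1 : (1 : ℝ) < q := by exact_mod_cast hq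
  have hq0 : (0 : ℝ) < q := by linarith
  have hqpos : 0 < q := by omega
  have hr1 : 1 ≤ r := one_le_asymptoticRank_matMulTensor K (Nat.one_le_pow _ _ hqpos)
    (Nat.one_le_pow _ _ hqpos) (Nat.one_le_pow _ _ hqpos)
  -- it suffices: `ω(a,b,c) ≤ log_q (r + δ)` for every `δ > 0`
  suffices h : ∀ δ : ℝ, 0 < δ → omegaRect K a b c ≤ Real.logb q (r + δ) by
    refine le_of_forall_pos_lt_add fun δ hδ => ?_
    have hrδ : 0 < r + δ / 2 := by linarith
    calc (q : ℝ) ^ omegaRect K a b c ≤ (q : ℝ) ^ Real.logb q (r + δ / 2) :=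
          Real.rpow_le_rpow_of_exponent_le hq1.le (h (δ / 2) (by linarith))
      _ = r + δ / 2 := Real.rpow_logb hq0 hq1.ne' hrδ
      _ < r + δ := by linarith
  intro δ hδ
  have hrδ1 : 1 < r + δ := by linarith
  have hrδ0 : 0 < r + δ := by linarith
  obtain ⟨n₀, hn₀, hRn₀⟩ := exists_tensorRank_kroneckerPow_le_pow K T hδ
  rw [← hr] at hRn₀
  -- the admissible exponent `β = log_q (r+δ)` with constant `C = (r+δ)^{n₀}`
  set β := Real.logb q (r + δ) with hβ
  have hβ0 : 0 ≤ β := Real.logb_nonneg hq1 hrδ1.le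
  have hqβ : (q : ℝ) ^ β = r + δ := Real.rpow_logb hq0 hq1.ne' hrδ0
  have hmem : β ∈ rectAdmissibleExponents K (a : ℝ) b c := by
    rw [rectAdmissibleExponents, Set.mem_setOf_eq, isBigO_iff]
    refine ⟨(r + δ) ^ n₀, ?_⟩
    filter_upwards [eventually_ge_atTop 1] with n hn1
    rw [Real.norm_of_nonneg (Nat.cast_nonneg _),
      Real.norm_of_nonneg (Real.rpow_nonneg (Nat.cast_nonneg _) _)]
    -- `i` with `q^{n₀ i} ≤ n < q^{n₀ (i+1)}`
    set i := Nat.log q n / n₀ with hi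
    have hlow : q ^ (n₀ * i) ≤ n := by
      have h1 : n₀ * i ≤ Nat.log q n := by
        rw [hi, mul_comm]; exact Nat.div_mul_le_self _ _
      exact (Nat.pow_le_pow_right hqpos h1).trans (Nat.pow_log_le_self q (by omega))
    have hupp : n < q ^ (n₀ * (i + 1)) := by
      have h1 : n < q ^ (Nat.log q n + 1) := Nat.lt_pow_succ_log_self hq n
      have h2 : Nat.log q n + 1 ≤ n₀ * (i + 1) := by
        have h3 := Nat.div_add_mod (Nat.log q n) n₀
        have h4 := Nat.mod_lt (Nat.log q n) (by omega : 0 < n₀)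
        rw [Nat.mul_succ, hi]
        omega
      exact h1.trans_le (Nat.pow_le_pow_right hqpos h2)
    have hnN : n ≤ q ^ (n₀ * (i + 1)) := hupp.le
    have hdim : ∀ d : ℕ, rectDim n (d : ℝ) ≤ (q ^ d) ^ (n₀ * (i + 1)) := fun d => by
      rw [rectDim_natCast, ← pow_mul, mul_comm d, pow_mul]
      exact Nat.pow_le_pow_left hnN d
    -- the chain of rank inequalities
    have hchain : (tensorRank (matMulTensor K (rectDim n a) (rectDim n b) (rectDim n c)) : ℝ) ≤
        (r + δ) ^ n₀ * (r + δ) ^ (n₀ * i) := by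
      have h1 : tensorRank (matMulTensor K (rectDim n a) (rectDim n b) (rectDim n c)) ≤
          tensorRank (matMulTensor K ((q ^ a) ^ (n₀ * (i + 1))) ((q ^ b) ^ (n₀ * (i + 1)))
            ((q ^ c) ^ (n₀ * (i + 1)))) :=
        tensorRank_matMulTensor_mono₃ K (hdim a) (hdim b) (hdim c)
      have h2 : tensorRank (matMulTensor K ((q ^ a) ^ (n₀ * (i + 1))) ((q ^ b) ^ (n₀ * (i + 1)))
          ((q ^ c) ^ (n₀ * (i + 1)))) = tensorRank (kroneckerPow T (n₀ * (i + 1))) := by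
        rw [hT, tensorRank_kroneckerPow_matMulTensor]
      have h3 : tensorRank (kroneckerPow T (n₀ * (i + 1))) ≤
          tensorRank (kroneckerPow T n₀) ^ (i + 1) := by
        rw [hT]; exact tensorRank_kroneckerPow_matMulTensor_mul_le K _ _ _ n₀ (i + 1)
      have h4 : ((tensorRank (kroneckerPow T n₀) ^ (i + 1) : ℕ) : ℝ) ≤ ((r + δ) ^ n₀) ^ (i + 1) := by
        push_cast
        exact pow_le_pow_left₀ (Nat.cast_nonneg _) hRn₀ (i + 1)
      calc (tensorRank (matMulTensor K (rectDim n a) (rectDim n b) (rectDim n c)) : ℝ)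
          ≤ ((tensorRank (kroneckerPow T n₀) ^ (i + 1) : ℕ) : ℝ) := by
            exact_mod_cast h1.trans (h2.le.trans h3)
        _ ≤ ((r + δ) ^ n₀) ^ (i + 1) := h4
        _ = (r + δ) ^ n₀ * (r + δ) ^ (n₀ * i) := by rw [pow_succ, pow_mul, mul_comm]
    -- `(r+δ)^{n₀ i} = (q^{n₀ i})^β ≤ n^β`
    have hpowβ : (r + δ) ^ (n₀ * i) ≤ (n : ℝ) ^ β := by
      have e1 : (r + δ) ^ (n₀ * i) = ((q ^ (n₀ * i) : ℕ) : ℝ) ^ β := by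
        rw [← hqβ, ← Real.rpow_mul_natCast hq0.le, mul_comm, Real.rpow_natCast_mul hq0.le]
        push_cast
        rfl
      rw [e1]
      exact Real.rpow_le_rpow (Nat.cast_nonneg _) (by exact_mod_cast hlow) hβ0
    calc (tensorRank (matMulTensor K (rectDim n a) (rectDim n b) (rectDim n c)) : ℝ)
        ≤ (r + δ) ^ n₀ * (r + δ) ^ (n₀ * i) := hchain
      _ ≤ (r + δ) ^ n₀ * (n : ℝ) ^ β := mul_le_mul_of_nonneg_left hpowβ (pow_nonneg hrδ0.le _)
  -- conclude: `ω(a,b,c) = inf ≤ β` (if the set were unbounded below the infimum is the junk `0 ≤ β`)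
  show sInf (rectAdmissibleExponents K (a : ℝ) b c) ≤ β
  by_cases hbdd : BddBelow (rectAdmissibleExponents K (a : ℝ) b c)
  · exact csInf_le hbdd hmem
  · rw [Real.sInf_of_not_bddBelow hbdd]; exact hβ0

/-- **`R̃(⟨q^a, q^b, q^c⟩) ≤ q^{ω(a,b,c)}`** for natural `a, b, c` and `q ≥ 2`: for an admissible
`β`, `R(T^{⊗k}) = R(⟨(q^k)^a, (q^k)^b, (q^k)^c⟩) ≤ C (q^k)^β` for `k` large, while
`R̃^k ≤ R(T^{⊗k})`; so `R̃ ≤ q^β` (otherwise `(R̃/q^β)^k > C` eventually).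
[cite: AlmanDuanVassilevskaWilliamsXuXuZhou2025, §3.4] -/
theorem asymptoticRank_matMulTensor_le_rpow_omegaRect {q : ℕ} (hq : 2 ≤ q) (a b c : ℕ) :
    asymptoticRank (matMulTensor K (q ^ a) (q ^ b) (q ^ c)) ≤ (q : ℝ) ^ omegaRect K a b c := by
  set T := matMulTensor K (q ^ a) (q ^ b) (q ^ c) with hT
  set r := asymptoticRank T with hr
  have hq1 : (1 : ℝ) < q := by exact_mod_cast hq
  have hq0 : (0 : ℝ) < q := by linarith
  have hqpos : 0 < q := by omega
  have hr1 : 1 ≤ r := one_le_asymptoticRank_matMulTensor K (Nat.one_le_pow _ _ hqpos)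
    (Nat.one_le_pow _ _ hqpos) (Nat.one_le_pow _ _ hqpos)
  have hr0 : 0 < r := by linarith
  -- for every admissible `β`: `r ≤ q^β`
  have key : ∀ β ∈ rectAdmissibleExponents K (a : ℝ) b c, r ≤ (q : ℝ) ^ β := by
    intro β hβmem
    obtain ⟨C, hC⟩ := isBigO_iff.1 hβmem
    have hqβ0 : 0 < (q : ℝ) ^ β := Real.rpow_pos_of_pos hq0 β
    -- along `n = q^k`
    have hC' : ∀ᶠ k : ℕ in atTop,
        (tensorRank (kroneckerPow T k) : ℝ) ≤ C * ((q : ℝ) ^ β) ^ k := by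
      have ht : Tendsto (fun k : ℕ => q ^ k) atTop atTop :=
        tendsto_pow_atTop_atTop_of_one_lt (by omega : 1 < q)
      filter_upwards [ht.eventually hC] with k hk
      rw [Real.norm_of_nonneg (Nat.cast_nonneg _),
        Real.norm_of_nonneg (Real.rpow_nonneg (Nat.cast_nonneg _) _)] at hk
      have e1 : tensorRank (kroneckerPow T k) = tensorRank (matMulTensor K (rectDim (q ^ k) a)
          (rectDim (q ^ k) b) (rectDim (q ^ k) c)) := by
        rw [hT, tensorRank_kroneckerPow_matMulTensor, rectDim_natCast, rectDim_natCast,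
          rectDim_natCast, ← pow_mul, ← pow_mul, ← pow_mul, mul_comm a, mul_comm b, mul_comm c,
          pow_mul, pow_mul, pow_mul]
      have e2 : (((q ^ k : ℕ) : ℝ)) ^ β = ((q : ℝ) ^ β) ^ k := by
        rw [← Real.rpow_mul_natCast hq0.le, mul_comm, Real.rpow_natCast_mul hq0.le]
        push_cast
        rfl
      rw [e1, ← e2]
      exact hk
    by_contra hlt
    rw [not_le] at hlt
    set ρ := r / (q : ℝ) ^ β with hρ
    have hρ1 : 1 < ρ := (one_lt_div hqβ0).2 hlt
    have hρq : ρ * (q : ℝ) ^ β = r := div_mul_cancel₀ r hqβ0.ne'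
    have hev : ∀ᶠ k : ℕ in atTop, C < ρ ^ k :=
      (tendsto_pow_atTop_atTop_of_one_lt hρ1).eventually_gt_atTop C
    obtain ⟨k, hk, hkC, hk1⟩ := (hC'.and (hev.and (eventually_ge_atTop 1))).exists
    -- `r^k ≤ R(T^{⊗k}) ≤ C (q^β)^k < ρ^k (q^β)^k = r^k`
    have hrk : r ^ k ≤ (tensorRank (kroneckerPow T k) : ℝ) := by
      have h := asymptoticRank_le_rpow T (by omega : 0 < k)
      rw [← hr] at h
      have hR0 : (0 : ℝ) ≤ tensorRank (kroneckerPow T k) := Nat.cast_nonneg _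
      have hk0 : (0 : ℝ) < k := by exact_mod_cast (by omega : 0 < k)
      calc r ^ k = r ^ ((k : ℕ) : ℝ) := (Real.rpow_natCast r k).symm
        _ ≤ (((tensorRank (kroneckerPow T k) : ℝ)) ^ ((k : ℝ)⁻¹)) ^ ((k : ℕ) : ℝ) :=
            Real.rpow_le_rpow hr0.le h (Nat.cast_nonneg _)
        _ = tensorRank (kroneckerPow T k) := by
            rw [← Real.rpow_mul hR0, inv_mul_cancel₀ hk0.ne', Real.rpow_one]
    have hlt' : C * ((q : ℝ) ^ β) ^ k < r ^ k := by
      calc C * ((q : ℝ) ^ β) ^ k < ρ ^ k * ((q : ℝ) ^ β) ^ k :=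
            mul_lt_mul_of_pos_right hkC (pow_pos hqβ0 k)
        _ = r ^ k := by rw [← mul_pow, hρq]
    linarith
  -- `log_q r ≤ β` for all admissible `β`, hence `≤ ω(a,b,c)`, hence `r ≤ q^{ω(a,b,c)}`
  have hlog : Real.logb q r ≤ omegaRect K a b c := by
    show Real.logb q r ≤ sInf (rectAdmissibleExponents K (a : ℝ) b c)
    refine le_csInf (rectAdmissibleExponents_nonempty K _ _ _) fun β hβ => ?_
    calc Real.logb q r ≤ Real.logb q ((q : ℝ) ^ β) := Real.logb_le_logb_of_le hq1 hr0 (key β hβ)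
      _ = β := Real.logb_rpow hq0 hq1.ne'
  calc r = (q : ℝ) ^ Real.logb q r := (Real.rpow_logb hq0 hq1.ne' hr0).symm
    _ ≤ (q : ℝ) ^ omegaRect K a b c := Real.rpow_le_rpow_of_exponent_le hq1.le hlog

/-- **`R̃(⟨q^a, q^b, q^c⟩) = q^{ω(a,b,c)}`** (`q ≥ 2`, natural `a, b, c`). [cite: AlmanDuanVassilevskaWilliamsXuXuZhou2025, §3.4] -/
theorem asymptoticRank_matMulTensor_rect {q : ℕ} (hq : 2 ≤ q) (a b c : ℕ) :
    asymptoticRank (matMulTensor K (q ^ a) (q ^ b) (q ^ c)) = (q : ℝ) ^ omegaRect K a b c :=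
  le_antisymm (asymptoticRank_matMulTensor_le_rpow_omegaRect K hq a b c)
    (rpow_omegaRect_le_asymptoticRank_matMulTensor K hq a b c)

/-- **ADVXXZ §3.4, the definition of the rectangular exponents by the asymptotic rank, as a
theorem about the tree's rank-form exponents: `ω(a,b,c) = log_q R̃(⟨q^a, q^b, q^c⟩)`** for every
integer `q ≥ 2` and natural exponents `a, b, c` (in particular the right-hand side does not depend on
`q`). [cite: AlmanDuanVassilevskaWilliamsXuXuZhou2025, §3.4] -/
theorem advxxz2025_omegaRect_eq_logb_asymptoticRank {q : ℕ} (hq : 2 ≤ q) (a b c : ℕ) :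
    omegaRect K a b c = Real.logb q (asymptoticRank (matMulTensor K (q ^ a) (q ^ b) (q ^ c))) := by
  have hq1 : (1 : ℝ) < q := by exact_mod_cast hq
  have hq0 : (0 : ℝ) < q := by linarith
  rw [asymptoticRank_matMulTensor_rect K hq, Real.logb_rpow hq0 hq1.ne']

end Main

end Literature.Computability.AlgebraicComplexity

end
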